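import Summits.QuantumFields.YangMills.Theorems.UnitScaleTiltProp7RCOfRowsFamily
import HarnessLib

/-!
# Route `UnitScaleTilt`, crux K1 child «MinimiserStabilityRegPr» (stmt-QuantumFields-19200), stub `stub_existenceMinimalOrbit` (EX), route (α) — **LIFT-THREAD 2, SED-TWIN T1∕D11 «RC-OF-ROWS» UNDER
# THE `Lift L i U₀` ANTECEDENT** — the v1 doors ✓`Prop7RCOfRowsFamily.hRC_of_rows_family` ∕ ✓`…hRC_of_rows_family_B₀` (px14 g3) with the opaque lift predicate threaded: token `Lift L i U₀ →`
# after the `RegPr … ρ U₀ → ρ ≤ α L →` guard of the consumed PRINT ROW `norm_Hπ` (print shape, as S41ᴸ∕S42ᴸ∕S43ᴸT2 display it with `α := αcap`) AND after the `RegPr … (α L) U₀ →` clause of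
# the conclusion `hRC` (op → op pass-through; both decls).

WHY.  px12 g11's LOCATE d8153c1b72719070: the displayed N06 row `hPcol` of S42ᴸ, asked for EVERY `U₀ ∈ RegPr ρ`, is not inhabitable on stratum (c) (✓p734809 `PcolImpliesNSPoincare`); repair (A)
of record (★★OWNER RULING №30; namer ★w2-19200 g9 17:13:49Z ∕ PEN ASSIGNMENT v1 17:22:48Z «w8 g12: D11 + D12, then D13»; px12 g11 SED LIST v0 2bd9ff01b2ba680a) = every print row, and every row
derived from one, is asked only for backgrounds `U₀` satisfying `Lift L i U₀` (the top-level parallel sections lift — the class of the record minimiser, where the rows are consumed; discharged at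
the junction by ✓`Prop7IrrLiftRowOfRecord.hIrrLift_of_record`).
Here the print row is [Balaban1985BackgroundPropagators] Thm 3.12 (3.133) for `H` at the slot `Δ_πᴾ` (`norm_Hπ`); its reader `hRC` (the Sect. C regime of `(H̃ᴾ, C̃)`) inherits the antecedent.
TOKEN CONVENTION (α)(β)(γ) of record (routeR-w6 g11 17:24:52Z, namer ★w2-19200 g9 «AGREED» 17:25:31Z): (α) the door carries the OPAQUE predicate binder `(Lift : ∀ L i, GaugeField … → Prop)` as its first explicit binder and the token `Lift L i U₀ →` (only the S-files instantiate `Lift :=` the 6-line clause of SIGNATURE-0 S43ᴸT2 532e4a648d626dc4); (β) the token sits immediately after the last regularity guard of each threaded row (`RegPr … (α L) U₀ →` ∕ `ρ ≤ α L →`); (γ) file∕namespace = v1 + `Lift`, theorem names unchanged.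
Statements = v1's VERBATIM but for the `Lift` binder and the two tokens each; proofs = v1's VERBATIM but for `intro … hLift` and `norm_Hπ … hreg le_rfl hLift` (the `_B₀` corollary passes
`Lift` by name); v1's member theorem ✓`Prop7RCOfRowsFamily.regime_WX_member` reused by name.  Readers of the twinned `hRC`: the D12 (a)∕(b) twins (`…V0CurrentRealityT3Lift`,
`…HWROfRowsFamilyLift`, this seat) and the T2 at-record doors D14∕D15 (px20 g8), D20 (★routeR-w1 g12).  v1's §3 E2E `hWR_of_normHπ_hV0_family` (no consumer in the tree) is not twinned.

Cell `ym3-torus`, width seat `ym-ust-19200-w8` (gen 12).  THEOREMS ONLY (0 `def`, 0 `sorry`, 0 `instance`); default heartbeats.  `--supports stmt-QuantumFields-19200 --as helper`, count-neutral.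
HONEST SCOPE.  Pass-through twins, no new mathematics; CONDITIONAL on their displayed rows (the print row `norm_Hπ` ([Balaban1985BackgroundPropagators] Thm 3.12 (3.133)) and the L-only windows; NOT proved here); nothing of the 13 print rows, `hThm2S`, the stub EX, the crux or rung R3 is
proved; YM₃ on T³ = rung R3 — NOT d = 4, NOT infinite volume, NOT a mass gap, NOT Clay; the YM gap is NOT proved.

References: T. Bałaban, CMP **102** (1985) 277–309 [Balaban1985Variational] ((44)–(49) pp.285–286, Prop. 4 (97)–(98) pp.292–293, (115)–(121) pp.294–295, (14) p.280); CMP **99** (1985) 389–434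
[Balaban1985BackgroundPropagators] (Thm 3.12 (3.133) p.421, (3.19)–(3.21) pp.393–394).
-/

set_option autoImplicit false

noncomputable section

open scoped InnerProductSpace ComplexConjugate Matrix.Norms.L2Operator BigOperators

namespace Summit.QuantumFields.YangMills.Theorems.Prop7RCOfRowsFamilyLift

open Literature.MathematicalPhysics.QuantumFieldTheory.Balaban1983to89
open Literature.MathematicalPhysics.QuantumFieldTheory.Balaban1983to89.T3ContinuumYM3Torus
open Literature.MathematicalPhysics.QuantumFieldTheory.Balaban1983to89.T3Thm1Carrier
open T3SectALandauChart (eta eta_pos)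
open T3PrintedRegularMinimiser (RegPr)
open B9SectCLatticeCarrier (Bond)
open B11Eq115Space (NegSup NegSize Space115 JetSup levWeight)
open B11Eq111FrakG (nabla115)
open B11Eq174Chart (Regime)
open B11Eq80Current (W80)
open B11Eq90V0GroupComposed (curV0full)
open B11Eq98CurrentSlot (Jcur)
open B11Eq98V0primeCurrentSlots (rieszτ)
open B9Eq3119DeltaPiCarrier (currentCLM)
open Summit.QuantumFields.YangMills.Theorems.Prop7SectET3Transport (periodsT3 siteEquiv bondEquiv bgOfCfg)
open Summit.QuantumFields.YangMills.Theorems.Prop7SectET3HilbertLetters (W₂ frobEquiv toL2)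
open Summit.QuantumFields.YangMills.Theorems.Prop7SectET3CurvedPropagators (H1f)
open Summit.QuantumFields.YangMills.Theorems.Prop7SectET3WilsonHessian (DeltaEtaSlot)
open Summit.QuantumFields.YangMills.Theorems.Prop7SectET3DeltaPiPInv (DeltaPiSlotP)
open Summit.QuantumFields.YangMills.Theorems.Prop7SymAvgTwSym (CmapTwS)
open Summit.QuantumFields.YangMills.Theorems.Prop7SectET3WCurrentProp4Rows (prop4Hyp_CmapTwS_conj_zeroJet)
open Summit.QuantumFields.YangMills.Theorems.Prop7HWROfRowsFamily (hWR_of_rows_family)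
open Summit.QuantumFields.YangMills.Theorems.Prop7RCOfRowsFamily (regime_WX_member)

/-- ★★★ **SED-TWIN T1∕D11 (LIFT-THREAD 2): «RC-OF-ROWS» UNDER THE `Lift L i U₀` ANTECEDENT** — v1 ✓`Prop7RCOfRowsFamily.hRC_of_rows_family` (regime constant `bH` free) with the opaque
predicate binder `Lift`, the token `Lift L i U₀ →` after `ρ ≤ α L →` in the consumed print row `norm_Hπ` and after `RegPr … (α L) U₀ →` in the conclusion `hRC` (convention (α)(β)(γ));
proof = v1's with `hLift` passed to `norm_Hπ`.  CONDITIONAL on `norm_Hπ` (print row, not proved).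
[cite: Balaban1985Variational, (117)–(121) p.295, (47)–(49) pp.285–286, Prop. 4 (97)–(98) pp.292–293, (14) p.280; Balaban1985BackgroundPropagators, Thm 3.12 (3.133) p.421, (3.19)–(3.21) pp.393–394] -/
theorem hRC_of_rows_family
    [hFL : ∀ F : T3Family, Fact (0 < (F.L : ℝ))] [hFη : ∀ (F : T3Family) (k : ℕ), Fact (0 < ((F.L : ℝ)⁻¹) ^ k)]
    (Lift : ∀ (L : ℕ) (i : Idx L), GaugeField (i.1.1.P i.1.2.2) 0 (Matrix.specialUnitaryGroup (Fin 2) ℂ) → Prop)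
    (B₀ α a₃ ef εC bH : ℕ → ℝ) (hB₀ : ∀ L, 1 < L → 0 < B₀ L) (hα : ∀ L, 1 < L → 0 < α L) (hef : ∀ L, 1 < L → 0 < ef L)
    (hWe : ∀ L : ℕ, 1 < L → 10 ^ 9 * (L : ℝ) ^ 2 * ef L ≤ 1) (hWε : ∀ L : ℕ, 1 < L → 10 ^ 12 * (L : ℝ) ^ 3 * α L ≤ 1)
    (c₀ cB : ℕ → ℝ) [hc₀ : ∀ L : ℕ, Fact (0 < c₀ L)] [hcB : ∀ L : ℕ, Fact (0 < cB L)]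
    (a : ∀ L : ℕ, Idx L → ℝ)
    -- ROW `norm_Hπ` — S13ᴰ's binder VERBATIM ([5] Thm 3.12 (3.133) for print's `H` at the slot Δ_πᴾ; DISPLAYED, N06)
    (norm_Hπ : ∀ (L : ℕ), 1 < L → ∀ (i : Idx L) (ρ : ℝ) (U₀ : GaugeField (i.1.1.P i.1.2.2) 0 (Matrix.specialUnitaryGroup (Fin 2) ℂ)),
      RegPr i.1.1 i.1.2.1 i.1.2.2 ρ U₀ → ρ ≤ α L → Lift L i U₀ → ∀ b, ‖H1f i.1.1 i.1.2.1 i.1.2.2 i.2.2.le (c₀ L) (cB L) (a L i) (DeltaPiSlotP i.1.1 i.1.2.1 i.1.2.2 i.2.2.le (c₀ L) (cB L) (a L i)) U₀ b‖ ≤ B₀ L * ‖b‖)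
    -- the regime constant dominates the (3.133) constant (take `bH := B₀`), and the chart radius is a radius
    (hbH : ∀ L : ℕ, 1 < L → B₀ L ≤ bH L) (hεC : ∀ L : ℕ, 1 < L → 0 ≤ εC L)
    -- NEW L-only windows: print's (121) first member, (118) (`j = θ = 0`), (121) second member at the (W-X′) constants `B₀ := bH L`, `C₄ := 40·(2·(3·(2·ef L + 2700·L·α L)))∕(ef L)²`, `a := a₃ L`, `ε₄ := εC L`
    (hdomC : ∀ L : ℕ, 1 < L → 2 * (εC L + a₃ L) ≤ ef L / 2)
    (hselfC : ∀ L : ℕ, 1 < L → bH L * (40 * (2 * (3 * (2 * ef L + 2700 * (L : ℝ) * α L))) / ef L ^ 2) * (εC L + a₃ L) ^ 2 ≤ εC L)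
    (hcontrC : ∀ L : ℕ, 1 < L → 4 * bH L * (40 * (2 * (3 * (2 * ef L + 2700 * (L : ℝ) * α L))) / ef L ^ 2) * (εC L + a₃ L) < 1) :
    -- CONCLUSION = S13ᴰ's `hRC` binder (:170–176) VERBATIM
    ∀ (L : ℕ), 1 < L → ∀ (i : Idx L) (U₀ : GaugeField (i.1.1.P i.1.2.2) 0 (Matrix.specialUnitaryGroup (Fin 2) ℂ)), RegPr i.1.1 i.1.2.1 i.1.2.2 (α L) U₀ → Lift L i U₀ →
      Regime (H1f i.1.1 i.1.2.1 i.1.2.2 i.2.2.le (c₀ L) (cB L) (a L i) (DeltaPiSlotP i.1.1 i.1.2.1 i.1.2.2 i.2.2.le (c₀ L) (cB L) (a L i)) U₀) 0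
        (fun A' : Space115 (i.1.1.L : ℝ) (((i.1.1.L : ℝ)⁻¹) ^ (i.1.2.2 - i.1.2.1)) (fun _ : Bond 3 (periodsT3 i.1.1 i.1.2.2) => i.1.2.2 - i.1.2.1)
            (fun _ : Bond 3 (periodsT3 i.1.1 i.1.2.2) × Fin 3 => i.1.2.2 - i.1.2.1) (nabla115 (((i.1.1.L : ℝ)⁻¹) ^ (i.1.2.2 - i.1.2.1)) (bgOfCfg i.1.1 i.1.2.2 U₀)) =>
          (-Complex.I) • CmapTwS i.1.1 i.1.2.1 i.1.2.2 i.2.2.le U₀ (((((eta i.1.1 i.1.2.1 i.1.2.2 : ℝ) : ℂ)) * Complex.I) • (fun b : PBond (i.1.1.P i.1.2.2) 0 => JetSup.equiv _ _ _ A' (bondEquiv i.1.1 i.1.2.2 b))))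
        (bH L) 0 (40 * (2 * (3 * (2 * ef L + 2700 * (L : ℝ) * α L))) / ef L ^ 2) (ef L / 2) 0 (a₃ L) (εC L) := by
  intro L hL i U₀ hreg hLift
  have hLi : (L : ℝ) = (i.1.1.L : ℝ) := by rw [i.2.1]
  have hWe' : 10 ^ 9 * (i.1.1.L : ℝ) ^ 2 * ef L ≤ 1 := by rw [← hLi]; exact hWe L hL
  have hWε' : 10 ^ 12 * (i.1.1.L : ℝ) ^ 3 * α L ≤ 1 := by rw [← hLi]; exact hWε L hL
  have hself' : bH L * (40 * (2 * (3 * (2 * ef L + 2700 * (i.1.1.L : ℝ) * α L))) / ef L ^ 2) * (εC L + a₃ L) ^ 2 ≤ εC L := by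
    rw [← hLi]; exact hselfC L hL
  have hcontr' : 4 * bH L * (40 * (2 * (3 * (2 * ef L + 2700 * (i.1.1.L : ℝ) * α L))) / ef L ^ 2) * (εC L + a₃ L) < 1 := by
    rw [← hLi]; exact hcontrC L hL
  have hbH' : 0 ≤ bH L := (hB₀ L hL).le.trans (hbH L hL)
  have hH : ∀ b, ‖H1f i.1.1 i.1.2.1 i.1.2.2 i.2.2.le (c₀ L) (cB L) (a L i) (DeltaPiSlotP i.1.1 i.1.2.1 i.1.2.2 i.2.2.le (c₀ L) (cB L) (a L i)) U₀ b‖ ≤ bH L * ‖b‖ :=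
    fun b => (norm_Hπ L hL i (α L) U₀ hreg le_rfl hLift b).trans (mul_le_mul_of_nonneg_right (hbH L hL) (norm_nonneg _))
  rw [hLi]
  exact regime_WX_member i.1.1 i.1.2.1 i.1.2.2 i.2.2.le (c₀ L) (cB L) (a L i) (hα L hL) (hef L hL) hWe' hWε' U₀ hreg hbH' (hεC L hL)
    hH (hdomC L hL) hself' hcontr'

/-- ★ **SED-TWIN T1∕D11 (LIFT-THREAD 2) AT `bH := B₀`** — v1 ✓`Prop7RCOfRowsFamily.hRC_of_rows_family_B₀` with the same binder and tokens (`hbH := le_rfl`); the S-chain's `hRC'` term.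
[cite: Balaban1985Variational, (117)–(121) p.295, Prop. 4 (97)–(98) pp.292–293, (14) p.280; Balaban1985BackgroundPropagators, Thm 3.12 (3.133) p.421, (3.19)–(3.21) pp.393–394] -/
theorem hRC_of_rows_family_B₀
    [hFL : ∀ F : T3Family, Fact (0 < (F.L : ℝ))] [hFη : ∀ (F : T3Family) (k : ℕ), Fact (0 < ((F.L : ℝ)⁻¹) ^ k)]
    (Lift : ∀ (L : ℕ) (i : Idx L), GaugeField (i.1.1.P i.1.2.2) 0 (Matrix.specialUnitaryGroup (Fin 2) ℂ) → Prop)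
    (B₀ α a₃ ef εC : ℕ → ℝ) (hB₀ : ∀ L, 1 < L → 0 < B₀ L) (hα : ∀ L, 1 < L → 0 < α L) (hef : ∀ L, 1 < L → 0 < ef L)
    (hWe : ∀ L : ℕ, 1 < L → 10 ^ 9 * (L : ℝ) ^ 2 * ef L ≤ 1) (hWε : ∀ L : ℕ, 1 < L → 10 ^ 12 * (L : ℝ) ^ 3 * α L ≤ 1)
    (c₀ cB : ℕ → ℝ) [hc₀ : ∀ L : ℕ, Fact (0 < c₀ L)] [hcB : ∀ L : ℕ, Fact (0 < cB L)]
    (a : ∀ L : ℕ, Idx L → ℝ)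
    (norm_Hπ : ∀ (L : ℕ), 1 < L → ∀ (i : Idx L) (ρ : ℝ) (U₀ : GaugeField (i.1.1.P i.1.2.2) 0 (Matrix.specialUnitaryGroup (Fin 2) ℂ)),
      RegPr i.1.1 i.1.2.1 i.1.2.2 ρ U₀ → ρ ≤ α L → Lift L i U₀ → ∀ b, ‖H1f i.1.1 i.1.2.1 i.1.2.2 i.2.2.le (c₀ L) (cB L) (a L i) (DeltaPiSlotP i.1.1 i.1.2.1 i.1.2.2 i.2.2.le (c₀ L) (cB L) (a L i)) U₀ b‖ ≤ B₀ L * ‖b‖)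
    (hεC : ∀ L : ℕ, 1 < L → 0 ≤ εC L)
    (hdomC : ∀ L : ℕ, 1 < L → 2 * (εC L + a₃ L) ≤ ef L / 2)
    (hselfC : ∀ L : ℕ, 1 < L → B₀ L * (40 * (2 * (3 * (2 * ef L + 2700 * (L : ℝ) * α L))) / ef L ^ 2) * (εC L + a₃ L) ^ 2 ≤ εC L)
    (hcontrC : ∀ L : ℕ, 1 < L → 4 * B₀ L * (40 * (2 * (3 * (2 * ef L + 2700 * (L : ℝ) * α L))) / ef L ^ 2) * (εC L + a₃ L) < 1) :
    ∀ (L : ℕ), 1 < L → ∀ (i : Idx L) (U₀ : GaugeField (i.1.1.P i.1.2.2) 0 (Matrix.specialUnitaryGroup (Fin 2) ℂ)), RegPr i.1.1 i.1.2.1 i.1.2.2 (α L) U₀ → Lift L i U₀ →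
      Regime (H1f i.1.1 i.1.2.1 i.1.2.2 i.2.2.le (c₀ L) (cB L) (a L i) (DeltaPiSlotP i.1.1 i.1.2.1 i.1.2.2 i.2.2.le (c₀ L) (cB L) (a L i)) U₀) 0
        (fun A' : Space115 (i.1.1.L : ℝ) (((i.1.1.L : ℝ)⁻¹) ^ (i.1.2.2 - i.1.2.1)) (fun _ : Bond 3 (periodsT3 i.1.1 i.1.2.2) => i.1.2.2 - i.1.2.1)
            (fun _ : Bond 3 (periodsT3 i.1.1 i.1.2.2) × Fin 3 => i.1.2.2 - i.1.2.1) (nabla115 (((i.1.1.L : ℝ)⁻¹) ^ (i.1.2.2 - i.1.2.1)) (bgOfCfg i.1.1 i.1.2.2 U₀)) =>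
          (-Complex.I) • CmapTwS i.1.1 i.1.2.1 i.1.2.2 i.2.2.le U₀ (((((eta i.1.1 i.1.2.1 i.1.2.2 : ℝ) : ℂ)) * Complex.I) • (fun b : PBond (i.1.1.P i.1.2.2) 0 => JetSup.equiv _ _ _ A' (bondEquiv i.1.1 i.1.2.2 b))))
        (B₀ L) 0 (40 * (2 * (3 * (2 * ef L + 2700 * (L : ℝ) * α L))) / ef L ^ 2) (ef L / 2) 0 (a₃ L) (εC L) :=
  hRC_of_rows_family Lift B₀ α a₃ ef εC B₀ hB₀ hα hef hWe hWε c₀ cB a norm_Hπ (fun _ _ => le_rfl) hεC hdomC hselfC hcontrC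

end Summit.QuantumFields.YangMills.Theorems.Prop7RCOfRowsFamilyLift

end
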